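import Mathlib
import Summits.Ventures.PercRepro2.RootLeafUKSide

/-!
# K4 reduced to the conditional correlation of `o ∈ K` and `b ∈ K` given `T′ = {u ↔ c}`
(blind cell PercRepro2, p4 g26; S3 (G4-u) item (ap), proofs/P4-G26-K4STRUCTURE.md §1)

With `T′ = Q ∩ {u ↔ c}`, `t′ = P(T′)`, `R = PD ⊔ T = {u ↮ a₂, u ↮ c}`, `R′ = PD ⊔ T′ = {a₂ ↮ u, a₂ ↮ c}`,
`X = {o ∈ K}`, `Y = {b ∈ K}` and `K4 = P(R,Y)·δK + P(R)·(b)` (RootLeafUKSide):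

* **`yT_le_yR`**: `P(R)·P(T′,Y) ≤ t′·P(R,Y)`, i.e. `P(b ∈ K | u ↔ c) ≤ P(b ∈ K | u ↮ c)` under `Q` —
  BHK06 Thm 1.4 on `Q` (`s = a₂`, `X = {u}`, up-sets `{b ∈ C_{a₂}}`, `{c ∈ C_u}`) after `Q = PD ⊔ T ⊔ T′`;
* **`K4_eq_cubic`**: `K4 = P(R′)P(R)P(T′,X,Y) + P(R′,X)P(R,Y)t′ − P(R′,X)P(R)P(T′,Y) − P(R′)P(R,Y)P(T′,X)`,
  the trilinear form whose diagonal is `K4` (`K4 = t′·P(R′)·P(R)·E[(X − P(X | R′))(Y − P(Y | R))| T′]`);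
* **`K4_nonneg_of_covT_nonneg`**: `P(T′,X)·P(T′,Y) ≤ t′·P(T′,X,Y) → 0 ≤ K4` — the exact identity
  `t′·K4 = P(R,Y)·t′·δK + P(R)·t′·(b)` with `t′·(b) ≥ −P(T′,Y)·δK` under the hypothesis, and then
  `t′·K4 ≥ δK·(t′·P(R,Y) − P(R)·P(T′,Y)) ≥ 0` by `deltaK_nonneg` and `yT_le_yR` (`t′ = 0` kills every
  `T′`-mass and `K4 = 0`). So the ONLY obstruction to `K4` is the negative correlation of `o ∈ K` and
  `b ∈ K` given `u ↔ c` (p4 g25's two-route instances), and `K4` bounds that negativity by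
  `(P(X | R′) − P(X | T′))·(P(Y | R) − P(Y | T′))` (the census-true claim (ap)).
-/

namespace Summit.Ventures.PercRepro2

open UnionCluster CovForm

namespace RootLeafU

namespace K4Red

variable {V : Type*} {E : Type*} [Fintype E] [DecidableEq E] [Fintype V] [DecidableEq V]
  {R : Type*} [Field R] [LinearOrder R] [IsStrictOrderedRing R]

variable (p : E → R) (ends : E → Sym2 V) (o a₂ c b u : V)

omit [Fintype E] [DecidableEq E] [Fintype V] [DecidableEq V] [LinearOrder R] [IsStrictOrderedRing R] in
/-- `{u ↔ c} ∩ {a₂ ↮ u} = T′`. -/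
lemma conn_inter_avoid_eq_Tp : connEvent ends u c ∩ avoidAll ends a₂ {u} = TEvent ends a₂ u c := by
  ext ω
  simp only [Set.mem_inter_iff, mem_connEvent, mem_avoidAll, Finset.mem_singleton, forall_eq, TEvent,
    Set.mem_compl_iff]
  constructor
  · rintro ⟨h1, h2⟩
    exact ⟨fun h => h2 (conn_symm h), h1⟩
  · rintro ⟨h1, h2⟩
    exact ⟨h2, fun h => h1 (conn_symm h)⟩

omit [Fintype E] [DecidableEq E] [Fintype V] [DecidableEq V] [LinearOrder R] [IsStrictOrderedRing R] in
/-- `{a₂ ↔ b} ∩ {u ↔ c} ∩ {a₂ ↮ u} = T′ ∩ {a₂ ↔ b}`. -/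
lemma bK_cL_avoid_eq : connEvent ends a₂ b ∩ connEvent ends u c ∩ avoidAll ends a₂ {u} =
    TEvent ends a₂ u c ∩ connEvent ends a₂ b := by
  rw [Set.inter_assoc, conn_inter_avoid_eq_Tp, Set.inter_comm]

/-- **`ȳ_T ≤ ȳ_R`**: `P(R)·P(T′,bK) ≤ t′·P(R,bK)`, i.e. `P(b ∈ K | u ↔ c) ≤ P(b ∈ K | u ↮ c)` under `Q` —
BHK06 Thm 1.4 on `Q` (`{b ∈ C_{a₂}}` and `{c ∈ C_u}` are negatively correlated given `a₂ ↮ u`),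
`P(T′,bK)·P(Q) ≤ P(Q,bK)·t′`, after `Q = PD ⊔ T ⊔ T′`. -/
theorem yT_le_yR (hp : IsProbVec p) :
    (prob p (PDEvent ends u a₂ c) + prob p (TEvent ends u a₂ c)) *
        prob p (TEvent ends a₂ u c ∩ connEvent ends a₂ b) ≤
      prob p (TEvent ends a₂ u c) *
        (prob p (PDEvent ends u a₂ c ∩ connEvent ends a₂ b) +
          prob p (TEvent ends u a₂ c ∩ connEvent ends a₂ b)) := by
  classical
  have h := bhk_cross_cluster_avoid p hp ends a₂ u (X := {u}) (Finset.mem_singleton_self u)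
    (isUpperSet_mem_setOf b) (isUpperSet_mem_setOf c)
  rw [← connEvent_eq_clusterInEvent ends a₂ b, ← connEvent_eq_clusterInEvent ends u c, bK_cL_avoid_eq,
    conn_inter_avoid_eq_Tp, Set.inter_comm (connEvent ends a₂ b) (avoidAll ends a₂ {u}),
    Qsplit p ends u a₂ c (connEvent ends a₂ b), Qsplit_univ p ends u a₂ c] at h
  nlinarith [h]

omit [Fintype V] [DecidableEq V] [LinearOrder R] [IsStrictOrderedRing R] in
/-- **`K4` as a cubic in the eight atoms**: `K4 = P(R′)·P(R)·P(T′,X,Y) + P(R′,X)·P(R,Y)·t′ −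
P(R′,X)·P(R)·P(T′,Y) − P(R′)·P(R,Y)·P(T′,X)` with `P(R′) = D + t′`, `P(R′,X) = P(PD,X) + P(T′,X)`,
`P(R) = D + t`, `P(R,Y) = P(PD,Y) + P(T,Y)` — the diagonal of the trilinear form of the three-copy reading. -/
lemma K4_eq_cubic :
    ((prob p (PDEvent ends u a₂ c ∩ connEvent ends a₂ b) + prob p (TEvent ends u a₂ c ∩ connEvent ends a₂ b)) * (prob p (TEvent ends a₂ u c) * prob p (PDEvent ends u a₂ c ∩ connEvent ends a₂ o) - prob p (PDEvent ends u a₂ c) * prob p (TEvent ends a₂ u c ∩ connEvent ends a₂ o)) + (prob p (PDEvent ends u a₂ c) + prob p (TEvent ends u a₂ c)) * ((prob p (PDEvent ends u a₂ c) + prob p (TEvent ends a₂ u c)) * prob p (TEvent ends a₂ u c ∩ (connEvent ends a₂ o ∩ connEvent ends a₂ b)) - (prob p (PDEvent ends u a₂ c ∩ connEvent ends a₂ o) + prob p (TEvent ends a₂ u c ∩ connEvent ends a₂ o)) * prob p (TEvent ends a₂ u c ∩ connEvent ends a₂ b))) =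
      (prob p (PDEvent ends u a₂ c) + prob p (TEvent ends a₂ u c)) * (prob p (PDEvent ends u a₂ c) + prob p (TEvent ends u a₂ c)) * prob p (TEvent ends a₂ u c ∩ (connEvent ends a₂ o ∩ connEvent ends a₂ b))
        + (prob p (PDEvent ends u a₂ c ∩ connEvent ends a₂ o) + prob p (TEvent ends a₂ u c ∩ connEvent ends a₂ o)) * (prob p (PDEvent ends u a₂ c ∩ connEvent ends a₂ b) + prob p (TEvent ends u a₂ c ∩ connEvent ends a₂ b)) * prob p (TEvent ends a₂ u c)
        - (prob p (PDEvent ends u a₂ c ∩ connEvent ends a₂ o) + prob p (TEvent ends a₂ u c ∩ connEvent ends a₂ o)) * (prob p (PDEvent ends u a₂ c) + prob p (TEvent ends u a₂ c)) * prob p (TEvent ends a₂ u c ∩ connEvent ends a₂ b)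
        - (prob p (PDEvent ends u a₂ c) + prob p (TEvent ends a₂ u c)) * (prob p (PDEvent ends u a₂ c ∩ connEvent ends a₂ b) + prob p (TEvent ends u a₂ c ∩ connEvent ends a₂ b)) * prob p (TEvent ends a₂ u c ∩ connEvent ends a₂ o) := by
  ring

/-- **`0 ≤ K4` whenever `o ∈ K` and `b ∈ K` are positively correlated given `T′`**:
`P(T′,oK)·P(T′,bK) ≤ t′·P(T′,oK,bK) → 0 ≤ K4`. Proof: `t′·(b) ≥ −P(T′,bK)·δK` under the hypothesis, so
`t′·K4 ≥ δK·(t′·P(R,bK) − P(R)·P(T′,bK)) ≥ 0` (`deltaK_nonneg`, `yT_le_yR`); when `t′ = 0` every `T′`-mass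
vanishes and `K4 = 0`. Hence the only obstruction to claim (ap) is `Cov(o ∈ K, b ∈ K | u ↔ c) < 0`. -/
theorem K4_nonneg_of_covT_nonneg (hp : IsProbVec p)
    (hcov : prob p (TEvent ends a₂ u c ∩ connEvent ends a₂ o) * prob p (TEvent ends a₂ u c ∩ connEvent ends a₂ b) ≤
      prob p (TEvent ends a₂ u c) * prob p (TEvent ends a₂ u c ∩ (connEvent ends a₂ o ∩ connEvent ends a₂ b))) :
    0 ≤ ((prob p (PDEvent ends u a₂ c ∩ connEvent ends a₂ b) + prob p (TEvent ends u a₂ c ∩ connEvent ends a₂ b)) * (prob p (TEvent ends a₂ u c) * prob p (PDEvent ends u a₂ c ∩ connEvent ends a₂ o) - prob p (PDEvent ends u a₂ c) * prob p (TEvent ends a₂ u c ∩ connEvent ends a₂ o)) + (prob p (PDEvent ends u a₂ c) + prob p (TEvent ends u a₂ c)) * ((prob p (PDEvent ends u a₂ c) + prob p (TEvent ends a₂ u c)) * prob p (TEvent ends a₂ u c ∩ (connEvent ends a₂ o ∩ connEvent ends a₂ b)) - (prob p (PDEvent ends u a₂ c ∩ connEvent ends a₂ o) + prob p (TEvent ends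 a₂ u c ∩ connEvent ends a₂ o)) * prob p (TEvent ends a₂ u c ∩ connEvent ends a₂ b))) := by
  classical
  have hδ := KMaster.deltaK_nonneg p ends o a₂ c u hp
  have hy := yT_le_yR p ends a₂ c b u hp
  have n_tp := prob_nonneg hp (TEvent ends a₂ u c)
  have n_D := prob_nonneg hp (PDEvent ends u a₂ c)
  have n_t := prob_nonneg hp (TEvent ends u a₂ c)
  have n_TY := prob_nonneg hp (TEvent ends a₂ u c ∩ connEvent ends a₂ b)
  have n_RY : 0 ≤ prob p (PDEvent ends u a₂ c ∩ connEvent ends a₂ b) + prob p (TEvent ends u a₂ c ∩ connEvent ends a₂ b) :=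
    add_nonneg (prob_nonneg hp _) (prob_nonneg hp _)
  have n_PDX := prob_nonneg hp (PDEvent ends u a₂ c ∩ connEvent ends a₂ o)
  rcases eq_or_lt_of_le n_tp with h0 | hpos
  · -- `t′ = 0`: every `T′`-mass vanishes and `K4 = 0`
    have ht : prob p (TEvent ends a₂ u c) = 0 := h0.symm
    have z : ∀ X : Set (Config E), prob p (TEvent ends a₂ u c ∩ X) = 0 :=
      fun X => le_antisymm (ht ▸ prob_mono hp Set.inter_subset_left) (prob_nonneg hp _)
    rw [z, z, z, ht]
    simp
  · -- `t′ > 0`: `t′·K4 ≥ δK·(t′·P(R,bK) − P(R)·P(T′,bK)) ≥ 0`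
    have key : 0 ≤ prob p (TEvent ends a₂ u c) * ((prob p (PDEvent ends u a₂ c ∩ connEvent ends a₂ b) + prob p (TEvent ends u a₂ c ∩ connEvent ends a₂ b)) * (prob p (TEvent ends a₂ u c) * prob p (PDEvent ends u a₂ c ∩ connEvent ends a₂ o) - prob p (PDEvent ends u a₂ c) * prob p (TEvent ends a₂ u c ∩ connEvent ends a₂ o)) + (prob p (PDEvent ends u a₂ c) + prob p (TEvent ends u a₂ c)) * ((prob p (PDEvent ends u a₂ c) + prob p (TEvent ends a₂ u c)) * prob p (TEvent ends a₂ u c ∩ (connEvent ends a₂ o ∩ connEvent ends a₂ b)) - (prob p (PDEvent ends u a₂ c ∩ connEvent ends a₂ o) + prob p (TEvent ends a₂ u c ∩ connEvent ends a₂ o)) * prob p (TEvent ends a₂ u c ∩ connEvent ends a₂ b))) := by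
      nlinarith [mul_nonneg hδ (sub_nonneg.2 hy), mul_nonneg (add_nonneg n_D n_t) (mul_nonneg (add_nonneg n_D n_tp) (sub_nonneg.2 hcov)), mul_nonneg n_RY (mul_nonneg n_tp hδ)]
    exact (mul_nonneg_iff_of_pos_left hpos).mp key

end K4Red

end RootLeafU

end Summit.Ventures.PercRepro2
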